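import Literature.NumberTheory.LFunctions.FeketePolyaKernelCertificatesBlock
import Literature.NumberTheory.LFunctions.FeketePolyaKernelSignTablesTwist
import HarnessLib

/-!
# Fekete–Pólya block certificates: the per-conductor wrappers (engine v4)

Topic `Literature/NumberTheory/LFunctions`; namespace `Literature.NumberTheory.LFunctions.FeketePolyaKernel`
(sequel of `FeketePolyaKernelCertificatesBlock.lean` and `FeketePolyaKernelSignTablesTwist.lean`). THEOREMS only
(no definition, no named fact, no `sorry`): for each conductor shape (`q` odd, `4m`, `8m`; `q` resp. `m` given by its
list `ps` of odd prime factors — primality by `norm_num`, the product by `decide` at the call site) and each parity,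
the statement of the `interval_cases` bullets of the `NoRealZero{Odd,Even}…` range files — every primitive quadratic
`χ` mod `q` of that parity has `L(σ, χ) ≠ 0` on `(0, 1)` — from EITHER the parity test OR a BLOCK certificate
`blockCert b e K (q·w) (tabs… b ps q w)` of order `K` along `χ↑(q·w)` with free digit width `b ≥ 2` and splitting
depth `e` (engine `lfunction_ne_zero_of_blockCert`; sign tables `isSignTab_tabs…`): `good_{odd,even}_of_{odd,four,eight}_blk`.
Same statement shapes as the `…_fpR` / `…_r2` wrappers of `FeketePolyaKernelCertificatesResidueWrappers.lean`, at
`≈ 1/20` of the kernel cost. Cell `parity-realchar`, kernel floor of the wide column, Fekete–Pólya lane (seat prover-2).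

## References

* H. L. Montgomery, R. C. Vaughan, *Multiplicative Number Theory I*, CUP 2007, §9.3 Thm 9.13, §11.2.1
  Exercises 7–8. [MontgomeryVaughan2007]
* M. Fekete, G. Pólya, *Über ein Problem von Laguerre*, Rend. Circ. Mat. Palermo 34 (1912) 89–120. [FeketePolya1912]
-/

namespace Literature.NumberTheory.LFunctions

namespace FeketePolyaKernel

open Literature.Barriers.RiemannHypothesis PrimitiveQuadratic FeketePolyaTable SmallModuli OddSmallModuliII
open scoped NumberTheorySymbols

/-- A product of odd numbers is odd. [folklore] -/
private theorem prod_mod_two' : ∀ (ps : List ℕ), (∀ p ∈ ps, p % 2 = 1) → ps.prod % 2 = 1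
  | [], _ => rfl
  | p :: rest, h => by
    rw [List.prod_cons, Nat.mul_mod, h p (by simp), prod_mod_two' rest fun p' hp' ↦ h p' (by simp [hp'])]

/-- All entries of the factor list are odd. [folklore] -/
private theorem odd_of_forall {ps : List ℕ} (hps : ps.Forall fun p ↦ p.Prime ∧ p ≠ 2) : ∀ p ∈ ps, p % 2 = 1 := by
  rw [List.forall_iff_forall_mem] at hps
  exact fun p hp ↦ (hps p hp).1.eq_two_or_odd.resolve_left (hps p hp).2

/-! ### Per-conductor wrappers keyed on `q` and a factor list (parity test or block certificate) -/

/-- Primitive characters of modulus `≥ 2` are non-trivial. [folklore] -/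
private theorem ne_one'' {q : ℕ} [NeZero q] {χ : DirichletCharacter ℂ q} (hprim : χ.IsPrimitive)
    (hq : 2 ≤ q) : χ ≠ 1 :=
  SiegelZeroQuality.ne_one_of_isPrimitive hprim hq

/-- **Odd characters, odd conductor `q = ∏ ps > 1`**: parity test or certificate, values from the residue
table of the factor list `ps`. [cite: MontgomeryVaughan2007, §11.2.1 Exercises 7 (g), 8] -/
theorem good_odd_of_odd_blk {q : ℕ} [NeZero q] (ps : List ℕ) (hps : ps.Forall fun p ↦ p.Prime ∧ p ≠ 2)
    (hprod : ps.prod = q) (hq1 : 1 < q) (w K b e : ℕ) (hw : w ≠ 0) (hK : 1 ≤ K) (hb : 2 ≤ b)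
    (h : valOddR (resTable ps) (q - 1) = 1 ∨ blockCert b e K (q * w) (tabsOdd b ps q w) = true) :
    ∀ χ : DirichletCharacter ℂ q, χ.IsQuadratic → χ.IsPrimitive → χ.Odd →
      ∀ σ : ℝ, 0 < σ → σ < 1 → χ.LFunction σ ≠ 0 := by
  have hq2 : q % 2 = 1 := hprod ▸ prod_mod_two' ps (odd_of_forall hps)
  intro χ hquad hprim hodd σ hσ _
  have hv : ∀ n : ℕ, (χ (n : ZMod q)).re = valOddR (resTable ps) n := fun n ↦ by
    rw [valOddR_eq hps hprod hq1, re_apply_eq_valOdd (Nat.odd_iff.mpr hq2) hq1 hprim hquad]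
  rcases h with hpar | hrun
  · exact (not_odd_of_val _ hv hpar hodd).elim
  · exact lfunction_ne_zero_of_blockCert χ (ne_one'' hprim hq1) hquad _ hv hw hK hb
      (isSignTab_tabsOdd hb ps hps hprod hw) hrun hσ

/-- **Even characters, odd conductor**: parity test or certificate. [cite: MontgomeryVaughan2007, §11.2.1 Exercises 7 (g), 8] -/
theorem good_even_of_odd_blk {q : ℕ} [NeZero q] (ps : List ℕ) (hps : ps.Forall fun p ↦ p.Prime ∧ p ≠ 2)
    (hprod : ps.prod = q) (hq1 : 1 < q) (w K b e : ℕ) (hw : w ≠ 0) (hK : 1 ≤ K) (hb : 2 ≤ b)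
    (h : valOddR (resTable ps) (q - 1) = -1 ∨ blockCert b e K (q * w) (tabsOdd b ps q w) = true) :
    ∀ χ : DirichletCharacter ℂ q, χ.IsQuadratic → χ.IsPrimitive → χ.Even →
      ∀ σ : ℝ, 0 < σ → σ < 1 → χ.LFunction σ ≠ 0 := by
  have hq2 : q % 2 = 1 := hprod ▸ prod_mod_two' ps (odd_of_forall hps)
  intro χ hquad hprim heven σ hσ _
  have hv : ∀ n : ℕ, (χ (n : ZMod q)).re = valOddR (resTable ps) n := fun n ↦ by
    rw [valOddR_eq hps hprod hq1, re_apply_eq_valOdd (Nat.odd_iff.mpr hq2) hq1 hprim hquad]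
  rcases h with hpar | hrun
  · exact (not_even_of_val _ hv hpar heven).elim
  · exact lfunction_ne_zero_of_blockCert χ (ne_one'' hprim hq1) hquad _ hv hw hK hb
      (isSignTab_tabsOdd hb ps hps hprod hw) hrun hσ

/-- **Odd characters, conductor `4m`, `m = ∏ ps > 1`**: parity test or certificate.
[cite: MontgomeryVaughan2007, §11.2.1 Exercises 7 (g), 8] -/
theorem good_odd_of_four_blk {q : ℕ} [NeZero q] (ps : List ℕ) (hps : ps.Forall fun p ↦ p.Prime ∧ p ≠ 2)
    (hprod : 4 * ps.prod = q) (hq1 : 4 < q) (w K b e : ℕ) (hw : w ≠ 0) (hK : 1 ≤ K) (hb : 2 ≤ b)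
    (h : valFourR (resTable ps) (q - 1) = 1 ∨ blockCert b e K (q * w) (tabsFour b ps q w) = true) :
    ∀ χ : DirichletCharacter ℂ q, χ.IsQuadratic → χ.IsPrimitive → χ.Odd →
      ∀ σ : ℝ, 0 < σ → σ < 1 → χ.LFunction σ ≠ 0 := by
  subst hprod
  set m := ps.prod with hm
  haveI : NeZero m := ⟨by omega⟩
  have hm2 : m % 2 = 1 := prod_mod_two' ps (odd_of_forall hps)
  intro χ hquad hprim hodd σ hσ _
  have hv : ∀ n : ℕ, (χ (n : ZMod (2 ^ 2 * m))).re = valFourR (resTable ps) n := fun n ↦ by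
    rw [valFourR_eq hps hm.symm (by omega), re_apply_eq_valFour (m := m) (Nat.odd_iff.mpr hm2) (by omega)
      hprim hquad]
  rcases h with hpar | hrun
  · exact (not_odd_of_val _ hv hpar hodd).elim
  · exact lfunction_ne_zero_of_blockCert χ (ne_one'' hprim (by omega)) hquad _ hv hw hK hb
      (isSignTab_tabsFour hb ps hps rfl hw) hrun hσ

/-- **Even characters, conductor `4m`**: parity test or certificate. [cite: MontgomeryVaughan2007, §11.2.1 Exercises 7 (g), 8] -/
theorem good_even_of_four_blk {q : ℕ} [NeZero q] (ps : List ℕ) (hps : ps.Forall fun p ↦ p.Prime ∧ p ≠ 2)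
    (hprod : 4 * ps.prod = q) (hq1 : 4 < q) (w K b e : ℕ) (hw : w ≠ 0) (hK : 1 ≤ K) (hb : 2 ≤ b)
    (h : valFourR (resTable ps) (q - 1) = -1 ∨ blockCert b e K (q * w) (tabsFour b ps q w) = true) :
    ∀ χ : DirichletCharacter ℂ q, χ.IsQuadratic → χ.IsPrimitive → χ.Even →
      ∀ σ : ℝ, 0 < σ → σ < 1 → χ.LFunction σ ≠ 0 := by
  subst hprod
  set m := ps.prod with hm
  haveI : NeZero m := ⟨by omega⟩
  have hm2 : m % 2 = 1 := prod_mod_two' ps (odd_of_forall hps)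
  intro χ hquad hprim heven σ hσ _
  have hv : ∀ n : ℕ, (χ (n : ZMod (2 ^ 2 * m))).re = valFourR (resTable ps) n := fun n ↦ by
    rw [valFourR_eq hps hm.symm (by omega), re_apply_eq_valFour (m := m) (Nat.odd_iff.mpr hm2) (by omega)
      hprim hquad]
  rcases h with hpar | hrun
  · exact (not_even_of_val _ hv hpar heven).elim
  · exact lfunction_ne_zero_of_blockCert χ (ne_one'' hprim (by omega)) hquad _ hv hw hK hb
      (isSignTab_tabsFour hb ps hps rfl hw) hrun hσ

/-- **Odd characters, conductor `8m`, `m = ∏ ps > 1`** (two value patterns): for each, parity test or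
certificate. [cite: MontgomeryVaughan2007, §11.2.1 Exercises 7 (g), 8] -/
theorem good_odd_of_eight_blk {q : ℕ} [NeZero q] (ps : List ℕ) (hps : ps.Forall fun p ↦ p.Prime ∧ p ≠ 2)
    (hprod : 8 * ps.prod = q) (hq1 : 8 < q) (w K b e : ℕ) (hw : w ≠ 0) (hK : 1 ≤ K) (hb : 2 ≤ b)
    (hA : valEightAR (resTable ps) (q - 1) = 1 ∨ blockCert b e K (q * w) (tabsEightA b ps q w) = true)
    (hB : valEightBR (resTable ps) (q - 1) = 1 ∨ blockCert b e K (q * w) (tabsEightB b ps q w) = true) :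
    ∀ χ : DirichletCharacter ℂ q, χ.IsQuadratic → χ.IsPrimitive → χ.Odd →
      ∀ σ : ℝ, 0 < σ → σ < 1 → χ.LFunction σ ≠ 0 := by
  subst hprod
  set m := ps.prod with hm
  haveI : NeZero m := ⟨by omega⟩
  have hm2 : m % 2 = 1 := prod_mod_two' ps (odd_of_forall hps)
  intro χ hquad hprim hodd σ hσ _
  rcases re_apply_eq_valEight (m := m) (Nat.odd_iff.mpr hm2) (by omega) hprim hquad with hv | hv
  · replace hv : ∀ n : ℕ, (χ (n : ZMod (2 ^ 3 * m))).re = valEightAR (resTable ps) n := fun n ↦ by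
      rw [valEightAR_eq hps hm.symm (by omega), hv]
    rcases hA with hpar | hrun
    · exact (not_odd_of_val _ hv hpar hodd).elim
    · exact lfunction_ne_zero_of_blockCert χ (ne_one'' hprim (by omega)) hquad _ hv hw hK hb
        (isSignTab_tabsEightA hb ps hps rfl hw) hrun hσ
  · replace hv : ∀ n : ℕ, (χ (n : ZMod (2 ^ 3 * m))).re = valEightBR (resTable ps) n := fun n ↦ by
      rw [valEightBR_eq hps hm.symm (by omega), hv]
    rcases hB with hpar | hrun
    · exact (not_odd_of_val _ hv hpar hodd).elim
    · exact lfunction_ne_zero_of_blockCert χ (ne_one'' hprim (by omega)) hquad _ hv hw hK hb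
        (isSignTab_tabsEightB hb ps hps rfl hw) hrun hσ

/-- **Even characters, conductor `8m`**: for each value pattern, parity test or certificate.
[cite: MontgomeryVaughan2007, §11.2.1 Exercises 7 (g), 8] -/
theorem good_even_of_eight_blk {q : ℕ} [NeZero q] (ps : List ℕ) (hps : ps.Forall fun p ↦ p.Prime ∧ p ≠ 2)
    (hprod : 8 * ps.prod = q) (hq1 : 8 < q) (w K b e : ℕ) (hw : w ≠ 0) (hK : 1 ≤ K) (hb : 2 ≤ b)
    (hA : valEightAR (resTable ps) (q - 1) = -1 ∨ blockCert b e K (q * w) (tabsEightA b ps q w) = true)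
    (hB : valEightBR (resTable ps) (q - 1) = -1 ∨ blockCert b e K (q * w) (tabsEightB b ps q w) = true) :
    ∀ χ : DirichletCharacter ℂ q, χ.IsQuadratic → χ.IsPrimitive → χ.Even →
      ∀ σ : ℝ, 0 < σ → σ < 1 → χ.LFunction σ ≠ 0 := by
  subst hprod
  set m := ps.prod with hm
  haveI : NeZero m := ⟨by omega⟩
  have hm2 : m % 2 = 1 := prod_mod_two' ps (odd_of_forall hps)
  intro χ hquad hprim heven σ hσ _
  rcases re_apply_eq_valEight (m := m) (Nat.odd_iff.mpr hm2) (by omega) hprim hquad with hv | hv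
  · replace hv : ∀ n : ℕ, (χ (n : ZMod (2 ^ 3 * m))).re = valEightAR (resTable ps) n := fun n ↦ by
      rw [valEightAR_eq hps hm.symm (by omega), hv]
    rcases hA with hpar | hrun
    · exact (not_even_of_val _ hv hpar heven).elim
    · exact lfunction_ne_zero_of_blockCert χ (ne_one'' hprim (by omega)) hquad _ hv hw hK hb
        (isSignTab_tabsEightA hb ps hps rfl hw) hrun hσ
  · replace hv : ∀ n : ℕ, (χ (n : ZMod (2 ^ 3 * m))).re = valEightBR (resTable ps) n := fun n ↦ by
      rw [valEightBR_eq hps hm.symm (by omega), hv]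
    rcases hB with hpar | hrun
    · exact (not_even_of_val _ hv hpar heven).elim
    · exact lfunction_ne_zero_of_blockCert χ (ne_one'' hprim (by omega)) hquad _ hv hw hK hb
        (isSignTab_tabsEightB hb ps hps rfl hw) hrun hσ


/-- Usage (kernel `decide`): `d = 53` (even, prime conductor) at order `3`, digits of `32` bits, splitting depth `2`;
`d = −52 = −4·13` at order `2`; `d = 104 = 8·13` (pattern `χ₈·(·/13)` even, the other pattern is odd). [folklore] -/
example : (∀ χ : DirichletCharacter ℂ 53, χ.IsQuadratic → χ.IsPrimitive → χ.Even →
      ∀ σ : ℝ, 0 < σ → σ < 1 → χ.LFunction σ ≠ 0) ∧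
    (∀ χ : DirichletCharacter ℂ 52, χ.IsQuadratic → χ.IsPrimitive → χ.Odd →
      ∀ σ : ℝ, 0 < σ → σ < 1 → χ.LFunction σ ≠ 0) ∧
    (∀ χ : DirichletCharacter ℂ 104, χ.IsQuadratic → χ.IsPrimitive → χ.Even →
      ∀ σ : ℝ, 0 < σ → σ < 1 → χ.LFunction σ ≠ 0) :=
  ⟨good_even_of_odd_blk [53] (by norm_num) (by decide) (by decide) 1 3 32 2 (by decide) (by decide) (by decide)
      (Or.inr (by decide +kernel)),
    good_odd_of_four_blk [13] (by norm_num) (by decide) (by decide) 1 2 32 2 (by decide) (by decide) (by decide)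
      (Or.inr (by decide +kernel)),
    good_even_of_eight_blk [13] (by norm_num) (by decide) (by decide) 1 2 32 2 (by decide) (by decide) (by decide)
      (by decide +kernel) (by decide +kernel)⟩

end FeketePolyaKernel

end Literature.NumberTheory.LFunctions
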